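import Mathlib
import HarnessLib
import Summits.NavierStokesRegularity.NavierStokesRegularity.Theorems.PoloidalWindowDoorPoloidalWindowRigiditySymmetryGerms
import Summits.NavierStokesRegularity.NavierStokesRegularity.Theorems.PoloidalWindowDoorLrcModEntireTwistingTHOscLiouville

/-!
# Item `LrcModEntire` (stmt-NavierStokesRegularity-20428), skeleton twist_split v6 — the CLASS road to `stub_twistingTHGerm` BY NAME modulo ONE
# analytic hypothesis object: «the plane oscillation admits a bounded similarity majorant obeying (OSC)» (= (h1) Ô-bound + (h2) derivation)

Cell ns-regularity-ideate, LEAD ns-poloidal-K2-p3 g13 (`--supports stmt-NavierStokesRegularity-20428`; memo OSC-LIOUVILLE-g13 v1.2 §5/§5quater).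

THE ROAD.  For a profile of the route's Type-I class, poloidal, with the hot spot of the registered stub, SUPPOSE (hypothesis object `hSim`, stated
for that profile) there are functions `Q, Qt, Ŝ : ℝ → ℝ → ℝ` of the similarity variables `(τ, ξ)` and constants `A > 0, c, C, k` with:
the regularity/bounds of `…TwistingTHOscLiouville.eq_zero_of_ancient_oscSubsolution_anyK` (`Q(τ,·) ∈ C²`, `∂_τQ = Qt`, `0 ≤ Q ≤ c`, polynomial bounds,
`Ŝ(τ,·) ∈ C¹`, `|Ŝ| ≤ A`), the similarity form of (OSC) `Qt + ½∂_ξ((ξ+Ŝ)Q) ≤ ∂_ξξQ` everywhere, and the LINK «`Q(τ,ξ) = 0` ⇒ the vorticity vanishes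
on the plane `{y₂ = ξe^{−τ/2}}` of the slice `t = −e^{−τ}`» (true for the genuine object `Q = √(−t)·osc_plane W`, `W` the Clebsch weight / vorticity
stream function, since `ω = (∂₁W, −∂₀W, 0)`).  THEN the conclusion of `stub_twistingTHGerm` holds — in fact `v ≡ 0`, contradicting the hot spot:
`eq_zero_of_ancient_oscSubsolution_anyK` gives `Q ≡ 0`, the link gives `curl v ≡ 0` on every slice, and `…SymmetryGerms.eq_zero_of_curl_eq_zero_on_open` ends.
* `eq_zero_of_similarityOsc` — class + the hypothesis object ⇒ `v ≡ 0`;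
* `twistingTHGerm_of_similarityOsc` — the registered signature of `stub_twistingTHGerm` VERBATIM, from the hypothesis object supplied for every
  normalised profile (the (TH)/window/pin binders are not even used: the road is a Liouville theorem for the whole poloidal class GIVEN the object).
So the (TH) column of `LrcModEntire` is, in the kernel, EXACTLY the task of producing `(Q, Qt, Ŝ)` — i.e. (h1) the scale-invariant bound
`√(−t)·osc_plane W ≤ c` toward the past (⇐ parabolic proximity of plane extremizers, `…Proximity`) and (h2) the a.e./viscosity derivation of (OSC) for the
plane envelopes with the stated regularity (`…Envelope.osc_divergence_form` + `…SimilarityMap.sim_subsolution` pointwise).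

WHAT THIS IS NOT: not a claim about Navier–Stokes regularity and not a proof of the stub — a reduction BY NAME to a typed analytic hypothesis
(bears_on LADDER-NS N0, item 20428 / crux 19708; both OPEN).
-/

noncomputable section

-- the summit and its single sub-problem share the name (CONVENTIONS §1), as in every Theorems file
set_option linter.dupNamespace false

namespace Summit.NavierStokesRegularity.NavierStokesRegularity.Theorems.PoloidalWindowDoorLrcModEntireTwistingTHOscRoad

open Set Filter Topology Function
open scoped RealInnerProductSpace InnerProductSpace Laplacian
open Literature.Analysis Literature.Analysis.FluidPDE
open Summit.NavierStokesRegularity.NavierStokesRegularity.Theorems.PoloidalWindowDoorPoloidalWindowRigiditySymmetryGerms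
open Summit.NavierStokesRegularity.NavierStokesRegularity.Theorems.PoloidalWindowDoorLrcModEntireTwistingTHOscLiouville

/-- **The similarity-(OSC) hypothesis object for one profile `v`**: bounded non-negative `Q` (with time derivative `Qt`), bounded drift `Ŝ`, the
regularity and polynomial bounds of `eq_zero_of_ancient_oscSubsolution_anyK`, the similarity form of (OSC), and the LINK to the vorticity of `v`
(`Q(τ,ξ) = 0` ⇒ `curl v(−e^{−τ}) = 0` on the plane `{y₂ = ξ e^{−τ/2}}`).  Stated as an explicit `∃` so that no definition is introduced. -/
theorem eq_zero_of_similarityOsc {C : ℝ} {v : ℝ → EuclideanSpace ℝ (Fin 3) → EuclideanSpace ℝ (Fin 3)}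
    (hrate : HasTypeITimeDecay C v) (hcont : ContinuousOn (uncurry v) (Iio (0 : ℝ) ×ˢ univ))
    (hmild : ∀ s t : ℝ, s < t → t < 0 → ∀ x,
      v t x = UnboundedOperators.heatExtension (v s) (t - s) x - oseenDuhamel 1 s v v t x)
    (hdiv : ∀ t < 0, VectorCalculus.IsDivFree (v t))
    (hSim : ∃ (Q Qt S : ℝ → ℝ → ℝ) (A c K : ℝ) (k : ℕ), 0 < A ∧
      (∀ τ, ContDiff ℝ 2 (Q τ)) ∧ (∀ τ ξ, HasDerivAt (fun τ' => Q τ' ξ) (Qt τ ξ) τ) ∧ (∀ τ, Continuous (Qt τ)) ∧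
      (∀ τ ξ, 0 ≤ Q τ ξ) ∧ (∀ τ ξ, Q τ ξ ≤ c) ∧
      (∀ τ ξ, |Qt τ ξ| ≤ K * (1 + ξ ^ 2) ^ k) ∧ (∀ τ ξ, |deriv (Q τ) ξ| ≤ K * (1 + ξ ^ 2) ^ k) ∧
      (∀ τ ξ, |deriv (deriv (Q τ)) ξ| ≤ K * (1 + ξ ^ 2) ^ k) ∧
      (∀ τ, ContDiff ℝ 1 (S τ)) ∧ (∀ τ ξ, |S τ ξ| ≤ A) ∧ (∀ τ ξ, |deriv (S τ) ξ| ≤ K * (1 + ξ ^ 2) ^ k) ∧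
      (∀ τ ξ, Qt τ ξ + (1 / 2 : ℝ) * deriv (fun ξ => (ξ + S τ ξ) * Q τ ξ) ξ ≤ deriv (deriv (Q τ)) ξ) ∧
      (∀ τ ξ, Q τ ξ = 0 → ∀ y : EuclideanSpace ℝ (Fin 3), y 2 = ξ * Real.exp (-τ / 2) → curl (v (-Real.exp (-τ))) y = 0)) :
    ∀ t < 0, ∀ x, v t x = 0 := by
  obtain ⟨Q, Qt, S, A, c, K, k, hA, hQ2, hQt, hQtc, h0, hc, hQtb, hQ1b, hQ2b, hS, hSA, hS1b, hsub, hlink⟩ := hSim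
  have hQ0 : ∀ τ ξ, Q τ ξ = 0 :=
    eq_zero_of_ancient_oscSubsolution_anyK hA hQ2 hQt hQtc h0 hc hQtb hQ1b hQ2b hS hSA hS1b hsub
  -- the vorticity vanishes on every plane of the slice `t = −1` (`τ = 0`)
  have hcurl : ∀ y : EuclideanSpace ℝ (Fin 3), curl (v (-1)) y = 0 := by
    intro y
    have h := hlink 0 (y 2) (hQ0 0 (y 2)) y (by simp)
    simpa using h
  exact eq_zero_of_curl_eq_zero_on_open hrate hcont hmild hdiv (s := -1) (by norm_num) isOpen_univ univ_nonempty
    fun y _ => hcurl y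

/-- **THE CLASS ROAD TO `stub_twistingTHGerm` BY NAME.**  If every poloidal class profile normalised at the hot spot (the binders of the registered stub,
up to and including the free pins) carries a similarity-(OSC) hypothesis object (`eq_zero_of_similarityOsc`), then the registered signature of
`stub_twistingTHGerm` (skeleton `Cruxes/LrcModEntire/Lines/twist_split.lean` v6) holds — vacuously, because such a profile is `≡ 0`, contradicting
`v₂(−1,0) ≠ 0`.  The window / (TH) / twist / pin binders of the stub are carried VERBATIM and unused. -/
theorem twistingTHGerm_of_similarityOsc
    (hH : ∀ (C : ℝ) (v : ℝ → EuclideanSpace ℝ (Fin 3) → EuclideanSpace ℝ (Fin 3)),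
      Literature.Analysis.FluidPDE.HasTypeITimeDecay C v →
      ContinuousOn (Function.uncurry v) (Set.Iio (0 : ℝ) ×ˢ Set.univ) →
      (∀ s t : ℝ, s < t → t < 0 → ∀ x, v t x =
        Literature.Analysis.UnboundedOperators.heatExtension (v s) (t - s) x -
          Literature.Analysis.FluidPDE.oseenDuhamel 1 s v v t x) →
      (∀ t < 0, Literature.Analysis.FluidPDE.VectorCalculus.IsDivFree (v t)) →
      (∀ s < 0, ∀ y, ⟪Literature.Analysis.FluidPDE.curl (v s) y, EuclideanSpace.single 2 1⟫_ℝ = 0) →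
      v (-1) 0 2 ≠ 0 → (∀ t < 0, ∀ x, Real.sqrt (-t) * |v t x 2| ≤ |v (-1) 0 2|) →
      ∃ (Q Qt S : ℝ → ℝ → ℝ) (A c K : ℝ) (k : ℕ), 0 < A ∧
        (∀ τ, ContDiff ℝ 2 (Q τ)) ∧ (∀ τ ξ, HasDerivAt (fun τ' => Q τ' ξ) (Qt τ ξ) τ) ∧ (∀ τ, Continuous (Qt τ)) ∧
        (∀ τ ξ, 0 ≤ Q τ ξ) ∧ (∀ τ ξ, Q τ ξ ≤ c) ∧
        (∀ τ ξ, |Qt τ ξ| ≤ K * (1 + ξ ^ 2) ^ k) ∧ (∀ τ ξ, |deriv (Q τ) ξ| ≤ K * (1 + ξ ^ 2) ^ k) ∧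
        (∀ τ ξ, |deriv (deriv (Q τ)) ξ| ≤ K * (1 + ξ ^ 2) ^ k) ∧
        (∀ τ, ContDiff ℝ 1 (S τ)) ∧ (∀ τ ξ, |S τ ξ| ≤ A) ∧ (∀ τ ξ, |deriv (S τ) ξ| ≤ K * (1 + ξ ^ 2) ^ k) ∧
        (∀ τ ξ, Qt τ ξ + (1 / 2 : ℝ) * deriv (fun ξ => (ξ + S τ ξ) * Q τ ξ) ξ ≤ deriv (deriv (Q τ)) ξ) ∧
        (∀ τ ξ, Q τ ξ = 0 → ∀ y : EuclideanSpace ℝ (Fin 3), y 2 = ξ * Real.exp (-τ / 2) →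
          Literature.Analysis.FluidPDE.curl (v (-Real.exp (-τ))) y = 0)) :
    ∀ (C : ℝ) (v : ℝ → EuclideanSpace ℝ (Fin 3) → EuclideanSpace ℝ (Fin 3)),
      Literature.Analysis.FluidPDE.HasTypeITimeDecay C v →
      ContinuousOn (Function.uncurry v) (Set.Iio (0 : ℝ) ×ˢ Set.univ) →
      (∀ s t : ℝ, s < t → t < 0 → ∀ x, v t x =
        Literature.Analysis.UnboundedOperators.heatExtension (v s) (t - s) x -
          Literature.Analysis.FluidPDE.oseenDuhamel 1 s v v t x) →
      (∀ t < 0, Literature.Analysis.FluidPDE.VectorCalculus.IsDivFree (v t)) →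
      (∀ s < 0, ∀ y, ⟪Literature.Analysis.FluidPDE.curl (v s) y, EuclideanSpace.single 2 1⟫_ℝ = 0) →
      v (-1) 0 2 ≠ 0 → (∀ t < 0, ∀ x, Real.sqrt (-t) * |v t x 2| ≤ |v (-1) 0 2|) →
      (∀ h : EuclideanSpace ℝ (Fin 3), fderiv ℝ (v (-1)) 0 h 2 = 0) →
      (deriv (fun s => v s 0 2) (-1) = v (-1) 0 2 / 2 ∧ v (-1) 0 2 * (Δ (fun y => v (-1) y 2)) 0 ≤ 0) →
      ∀ W : Set (ℝ × EuclideanSpace ℝ (Fin 3)), IsOpen W → W.Nonempty → W ⊆ Set.Iio (0 : ℝ) ×ˢ Set.univ →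
        (∀ z ∈ W, (Literature.Analysis.FluidPDE.curl (v z.1) z.2 ≠ 0 ∧
            (fderiv ℝ (v z.1) z.2 (EuclideanSpace.single 0 1) 2 ≠ 0 ∨ fderiv ℝ (v z.1) z.2 (EuclideanSpace.single 1 1) 2 ≠ 0) ∧
            (fderiv ℝ (v z.1) z.2 (EuclideanSpace.single 2 1) 0 ≠ 0 ∨ fderiv ℝ (v z.1) z.2 (EuclideanSpace.single 2 1) 1 ≠ 0))) →
        (∀ m : ℝ → ℝ, ∀ W₁ : Set (ℝ × EuclideanSpace ℝ (Fin 3)), W₁ ⊆ W → IsOpen W₁ → W₁.Nonempty →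
            ∃ z ∈ W₁, ∃ b : Fin 3, b ≠ 2 ∧
              fderiv ℝ (v z.1) z.2 (EuclideanSpace.single 2 1) b ≠
                m z.1 * fderiv ℝ (v z.1) z.2 (EuclideanSpace.single b 1) 2) →
        (∀ z ∈ W, (fderiv ℝ (fun x => fderiv ℝ (v z.1) x (EuclideanSpace.single 2 1) 2) z.2 (EuclideanSpace.single 0 1) *
                fderiv ℝ (v z.1) z.2 (EuclideanSpace.single 1 1) 2 -
              fderiv ℝ (fun x => fderiv ℝ (v z.1) x (EuclideanSpace.single 2 1) 2) z.2 (EuclideanSpace.single 1 1) *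
                fderiv ℝ (v z.1) z.2 (EuclideanSpace.single 0 1) 2 ≠ 0)) →
        (∃ m : ℝ → ℝ → ℝ, ∀ z ∈ W, ∀ b : Fin 3, b ≠ 2 →
            fderiv ℝ (v z.1) z.2 (EuclideanSpace.single 2 1) b =
              m z.1 (z.2 2) * fderiv ℝ (v z.1) z.2 (EuclideanSpace.single b 1) 2) →
        ∃ s : ℝ, s < 0 ∧ ∃ U : Set (EuclideanSpace ℝ (Fin 3)), IsOpen U ∧ U.Nonempty ∧
          ((∃ e : EuclideanSpace ℝ (Fin 3), e ≠ 0 ∧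
              ∀ y ∈ U, fderiv ℝ (Literature.Analysis.FluidPDE.curl (v s)) y e = 0) ∨
           (∃ c : EuclideanSpace ℝ (Fin 3), ∀ y ∈ U,
              Literature.Analysis.FluidPDE.rotGen (Literature.Analysis.FluidPDE.curl (v s) y) =
                fderiv ℝ (Literature.Analysis.FluidPDE.curl (v s)) y (Literature.Analysis.FluidPDE.rotGen (y - c))) ∨
           (∃ w : EuclideanSpace ℝ (Fin 3) → EuclideanSpace ℝ (Fin 3), AnalyticOnNhd ℝ w Set.univ ∧
              ¬ BddAbove (Set.range fun y => ‖w y‖) ∧ ∀ y ∈ U, v s y = w y)) := by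
  intro C v hrate hcont hmild hdiv hpol hne hhot _hthread _hpins W _hW _hWne _hWs _hnd _hpin _htw _hTH
  have hzero := eq_zero_of_similarityOsc hrate hcont hmild hdiv (hH C v hrate hcont hmild hdiv hpol hne hhot)
  have h0 : v (-1) 0 = 0 := hzero (-1) (by norm_num) 0
  exact absurd (by rw [h0]; rfl) hne

end Summit.NavierStokesRegularity.NavierStokesRegularity.Theorems.PoloidalWindowDoorLrcModEntireTwistingTHOscRoad
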